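import Mathlib.MeasureTheory.Integral.Gamma
import Mathlib.Analysis.SpecialFunctions.Gaussian.GaussianIntegral
import Summits.QuantumFields.BalabanUV.Beta.EriceRemainderEnclosureHistoryAutonomyComparisonKernelEnergy

/-!
# EriceRemainderEnclosureHistoryAutonomyComparisonKernelPSD — THE PSD ROAD TO THE SHARP WINDOW CONSTANT: (i) for ANY kernel, positive
# semi-definiteness of the geometric reads `σ_ij = √(a_ij a_ji)` plus a reference vector `ν` with potential `(σν) ≥ c` on the support and energy `E`
# give `Σ_j L_j∕P_j ≤ 1∕(2c − E)` (with the Perron sandwich of `…ComparisonKernelEnergy`); (ii) THE GEOMETRIC AGE KERNEL `(jk)^{1∕4}∕√(j+k)` IS POSITIVE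
# SEMI-DEFINITE (`1∕√(j+k) = Γ(½)⁻¹·∫_0^∞ x^{−1∕2} e^{−(j+k)x} dx`, Mathlib's Gamma integral); (iii) hence, CONDITIONALLY ON THE CHORD INEQUALITY
# `ρ + σ(K₀,K₁) ≤ σ(m,K₀) + σ(m,K₁)` at the supported ages `m ∈ [K₀,K₁]`, the SHARP bound **`Σ_j L_j∕P_j ≤ 2∕(ρ + σ(K₀,K₁))`** — the exact two-point
# supremum of gen 100's memo, `≤ 2` iff `K₁∕K₀ ≤ 133.87` — for every profile on the window (any number of ages, any sizes, any Markov weight)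

Cell `pub-balaban`, β-function sub-cell, BINDER row D4 «RemainderConst leaves for Bałaban's split» (`HOME/BINDER-OWNERS.md`; owner lineage `b2b-balaban-beta-an4`;
this file by co-owner #3 lineage `b2b-balaban-beta-d4-p3`, generation 101, road P3), β-FLOW TEAM duty (1), FREEZE (0) honoured (def-free; `…ComparisonKernelEnergy`'s
`energy_le_sum`, Mathlib's `integral_rpow_mul_exp_neg_mul_rpow` ∕ `integrableOn_rpow_mul_exp_neg_mul_rpow` ∕ `integral_finsetSum` ∕ `setIntegral_nonneg` BY NAME;
nothing restated).  Third file of gen 101's station (P3·W) after `…ComparisonKernelEnergy` (p572068: sandwich, line lemma, affine minorant) and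
`…ComparisonWindowHundred` (p572742: factor `e^{8(2−√2)} ≈ 108` unconditionally).

HONEST FRAMING (page 1, verbatim and binding).  *"Discharging BetaPertH makes Bałaban's UV stability UNCONDITIONAL — a real constructive-QFT result; it is
NOT the continuum limit and NOT the Clay problem."*  THIS FILE DISCHARGES NOTHING OF THE KIND.  Elementary real analysis (finite sums, `√`, one Gamma
integral) about the cell's own NOT-IN-PRINT comparison binder (conjecture (E58′)); the age profile of Bałaban's (1.22) limit functional is NOT PRINTED ([I]
p. 298; GAPS G-t4-U2-1∕-2) and NOT asserted.  Row D4 class UNCHANGED (critical-path width 0; instance 0∕1; D4 DISCHARGE NO DATE).  HONEST DEPENDENCY: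
continuum YM on T⁴ ⇐ BetaPertH ∧ nine spine estimates (0/9 proved); BetaPertH ⇐ (D1) ∧ (D4) ∧ CAP+tail; G-an2-4 gates asym, D1 and NE2/3/4.

THE POINT (census sense (α); the COMPARISON column).  `…ComparisonKernelEnergy`: `Σ_j f_j ≤ 1∕m` for the loads `f_j = L_j∕P_j` whenever `fᵀσf ≥ m(Σf)²` on
the support, `σ_ij = √(a_ij a_ji)`.  When `σ` is POSITIVE SEMI-DEFINITE the energy `f ↦ fᵀσf` is convex, so its minimum over probability vectors on the age
set is certified by first-order conditions: §1 **`sum_div_le_inv_of_psd_potential`** — `0 ≤ (f − sν)ᵀσ(f − sν)` for ANY reference vector `ν` gives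
`fᵀσf ≥ 2s⟨σν,f⟩ − s²νᵀσν ≥ s²(2c − E)` if the potential `(σν)_i ≥ c` at every supported `i`, hence `Σ_j f_j ≤ 1∕(2c − E)`.  §2: for the age kernel
`s_jk = √(j∕(j+k))` the geometric reads are `σ_jk = (jk)^{1∕4}∕√(j+k) = c_jc_k∕√(j+k)` (`c = (·)^{1∕4}`), and **`Σ_{ij} c_ic_j∕√(k_i+k_j) = Γ(½)⁻¹·∫_0^∞ x^{−1∕2}
(Σ_i c_i e^{−k_ix})² dx ≥ 0`** (`inv_sqrt_eq_gamma_integral`, **`sum_mul_div_sqrt_add_nonneg`**, **`geomRead_psd`**, `geomRead_psd_nat` — the index `0` of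
the Markov weight has a vanishing row).  §3 **`profileSum_le_two_point_of_chord`**: `ν = ½(δ_{K₀} + δ_{K₁})` on a window `[K₀,K₁]` has energy
`E = ½(ρ + σ(K₀,K₁))` (`σ(k,k) = ρ = √(1∕2)`) and potential `½(σ(i,K₀) + σ(i,K₁))`, which is `≥ c := E` at every supported age EXACTLY WHEN THE CHORD
INEQUALITY `ρ + σ(K₀,K₁) ≤ σ(m,K₀) + σ(m,K₁)` holds there (`2c − E = E`): then **`Σ_{j<K} L_j∕P_j ≤ 2∕(ρ + σ(K₀,K₁))`**, the two-point value
`2∕(ρ + R^{1∕4}∕√(1+R))` (`R = K₁∕K₀`) of gen 100's memo F1 — so the chord inequality is ALSO NECESSARY for nothing better to exist, and the profile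
condition `≤ 2` follows iff `ρ + σ ≥ 1` iff `R ≤ 133.87…`.  In the coordinate `u = log k` the kernel is `ψ(u) = (2cosh(u∕2))^{−1∕2}` and the chord
inequality reads `ψ(s) + ψ(ℓ − s) ≥ ψ(0) + ψ(ℓ)` (`0 ≤ s ≤ ℓ = log R`): `ψ` is concave on `[0, 2.29]` and convex beyond; numerically the inequality holds up
to `ℓ ≈ log 300–350` (gen 100's KKT flip «third age profitable from ≈ 400»; `HOME/b2b-balaban-beta-d4-p3/g101/tool/memo_numbers.py`), with equality at
`s = 0` and first-order contact there.  NOT CLAIMED: the chord inequality itself (the ONE residual input for the sharp form of (E58b-W); a clean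
two-variable statement about `ψ`, e.g. for interval arithmetic with the tree's kernel-evaluable `log`∕`√` enclosures); anything printed.

WHAT IS PROVED ([folklore]; 0 `def`, 0 sorry).  §1 **`sum_div_le_inv_of_psd_potential`**.  §2 `inv_sqrt_eq_gamma_integral`, **`sum_mul_div_sqrt_add_nonneg`**,
**`geomRead_psd`**, `geomRead_psd_nat`.  §3 **`profileSum_le_two_point_of_chord`**.
-/
noncomputable section
open Finset Set MeasureTheory

namespace Summit.QuantumFields.BalabanUV.Beta.EriceRemainderEnclosureHistoryAutonomyComparisonKernelPSD

open Summit.QuantumFields.BalabanUV.Beta.EriceRemainderEnclosureHistoryAutonomyComparisonKernelEnergy (energy_le_sum)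

/-! ## §1 The energy bound from positive semi-definiteness and a reference measure with large potential -/

/-- **PSD + POTENTIAL ⟹ THE LOAD SUM BOUND.**  Kernel `a ≥ 0`, weights `L ≥ 0`, reads `P_i = Σ_k L_k a_ik`, loads `f_i = L_i∕P_i`, geometric kernel
`σ_ij = √(a_ij a_ji)`.  If `σ` is POSITIVE SEMI-DEFINITE on the index set and a reference vector `ν` (any signs, any mass) has potential `(σν)_i ≥ c` at
every supported index, with energy `E = νᵀσν` and `2c − E > 0`, then **`Σ_j f_j ≤ 1∕(2c − E)`**: `0 ≤ (f − sν)ᵀσ(f − sν)` (`s = Σf`) gives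
`fᵀσf ≥ 2s·⟨σν, f⟩ − s²E ≥ s²(2c − E)`, and `fᵀσf ≤ s` by the Perron sandwich `energy_le_sum`.  (For the minimal-energy `ν` — constant potential on its
support, `≥` elsewhere — `2c − E = E` and the bound is the reciprocal of the minimal energy.) [folklore] -/
theorem sum_div_le_inv_of_psd_potential {ι : Type*} {S : Finset ι} {a : ι → ι → ℝ} {L P ν : ι → ℝ} {c : ℝ}
    (ha : ∀ i j, 0 ≤ a i j) (hL : ∀ i, 0 ≤ L i) (hP : ∀ i, P i = ∑ k ∈ S, L k * a i k)
    (hpsd : ∀ g : ι → ℝ, 0 ≤ ∑ i ∈ S, ∑ j ∈ S, Real.sqrt (a i j * a j i) * g i * g j)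
    (hpot : ∀ i ∈ S, 0 < L i / P i → c ≤ ∑ j ∈ S, Real.sqrt (a i j * a j i) * ν j)
    (hm : 0 < 2 * c - ∑ i ∈ S, ∑ j ∈ S, Real.sqrt (a i j * a j i) * ν i * ν j) :
    ∑ j ∈ S, L j / P j ≤ 1 / (2 * c - ∑ i ∈ S, ∑ j ∈ S, Real.sqrt (a i j * a j i) * ν i * ν j) := by
  set f : ι → ℝ := fun i => L i / P i with hf
  set E : ℝ := ∑ i ∈ S, ∑ j ∈ S, Real.sqrt (a i j * a j i) * ν i * ν j with hE
  have hP0 : ∀ i, 0 ≤ P i := fun i => by rw [hP i]; exact sum_nonneg fun k _ => mul_nonneg (hL k) (ha i k)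
  have hf0 : ∀ i, 0 ≤ f i := fun i => div_nonneg (hL i) (hP0 i)
  change ∑ j ∈ S, f j ≤ 1 / (2 * c - E)
  set s : ℝ := ∑ i ∈ S, f i with hs
  have hs0 : 0 ≤ s := sum_nonneg fun i _ => hf0 i
  have hsym : ∀ i j, Real.sqrt (a i j * a j i) = Real.sqrt (a j i * a i j) := fun i j => by rw [mul_comm]
  -- the Perron sandwich
  have hup : ∑ i ∈ S, ∑ j ∈ S, Real.sqrt (a i j * a j i) * f i * f j ≤ s := energy_le_sum ha hL hP
  -- expand `(f − sν)ᵀ σ (f − sν) ≥ 0`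
  have hq := hpsd fun i => f i - s * ν i
  have hexp : ∑ i ∈ S, ∑ j ∈ S, Real.sqrt (a i j * a j i) * (f i - s * ν i) * (f j - s * ν j)
      = ∑ i ∈ S, ∑ j ∈ S, Real.sqrt (a i j * a j i) * f i * f j
        - 2 * s * ∑ i ∈ S, f i * ∑ j ∈ S, Real.sqrt (a i j * a j i) * ν j + s ^ 2 * E := by
    have e1 : ∀ i ∈ S, ∀ j ∈ S, Real.sqrt (a i j * a j i) * (f i - s * ν i) * (f j - s * ν j)
        = Real.sqrt (a i j * a j i) * f i * f j - s * (f i * (Real.sqrt (a i j * a j i) * ν j))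
          - s * (f j * (Real.sqrt (a j i * a i j) * ν i)) + s ^ 2 * (Real.sqrt (a i j * a j i) * ν i * ν j) := by
      intro i _ j _; rw [hsym j i]; ring
    rw [sum_congr rfl fun i hi => sum_congr rfl fun j hj => e1 i hi j hj]
    have hB : ∑ i ∈ S, ∑ j ∈ S, s * (f i * (Real.sqrt (a i j * a j i) * ν j))
        = s * ∑ i ∈ S, f i * ∑ j ∈ S, Real.sqrt (a i j * a j i) * ν j := by
      rw [mul_sum]
      exact sum_congr rfl fun i _ => by rw [mul_sum, mul_sum]
    have hC : ∑ i ∈ S, ∑ j ∈ S, s * (f j * (Real.sqrt (a j i * a i j) * ν i))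
        = s * ∑ i ∈ S, f i * ∑ j ∈ S, Real.sqrt (a i j * a j i) * ν j := by
      rw [sum_comm, mul_sum]
      exact sum_congr rfl fun i _ => by rw [mul_sum, mul_sum]
    have hD : ∑ i ∈ S, ∑ j ∈ S, s ^ 2 * (Real.sqrt (a i j * a j i) * ν i * ν j) = s ^ 2 * E := by
      rw [hE, mul_sum]
      exact sum_congr rfl fun i _ => by rw [mul_sum]
    have hsplit : ∑ i ∈ S, ∑ j ∈ S, (Real.sqrt (a i j * a j i) * f i * f j - s * (f i * (Real.sqrt (a i j * a j i) * ν j))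
          - s * (f j * (Real.sqrt (a j i * a i j) * ν i)) + s ^ 2 * (Real.sqrt (a i j * a j i) * ν i * ν j))
        = ∑ i ∈ S, ∑ j ∈ S, Real.sqrt (a i j * a j i) * f i * f j
          - ∑ i ∈ S, ∑ j ∈ S, s * (f i * (Real.sqrt (a i j * a j i) * ν j))
          - ∑ i ∈ S, ∑ j ∈ S, s * (f j * (Real.sqrt (a j i * a i j) * ν i))
          + ∑ i ∈ S, ∑ j ∈ S, s ^ 2 * (Real.sqrt (a i j * a j i) * ν i * ν j) := by
      rw [← sum_sub_distrib, ← sum_sub_distrib, ← sum_add_distrib]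
      refine sum_congr rfl fun i _ => ?_
      rw [← sum_sub_distrib, ← sum_sub_distrib, ← sum_add_distrib]
    rw [hsplit, hB, hC, hD]
    ring
  have hcross : c * s ≤ ∑ i ∈ S, f i * ∑ j ∈ S, Real.sqrt (a i j * a j i) * ν j := by
    rw [hs, mul_sum]
    refine sum_le_sum fun i hi => ?_
    rcases (hf0 i).eq_or_lt with h0 | hpos
    · rw [← h0]; simp
    · rw [mul_comm]
      exact mul_le_mul_of_nonneg_left (hpot i hi hpos) hpos.le
  rw [hexp] at hq
  have hchain : (2 * c - E) * s ^ 2 ≤ s := by nlinarith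
  rcases hs0.eq_or_lt with h0 | hspos
  · rw [← h0]; positivity
  · rw [le_div_iff₀ hm]
    nlinarith

/-! ## §2 The geometric age kernel `(jk)^{1∕4}∕√(j+k)` is positive semi-definite (`1∕√(j+k)` is a Gamma integral) -/

/-- `1∕√b = Γ(½)⁻¹·∫_0^∞ x^{−1∕2}·e^{−bx} dx` for `b > 0` (Mathlib's `integral_rpow_mul_exp_neg_mul_rpow`). [folklore] -/
theorem inv_sqrt_eq_gamma_integral {b : ℝ} (hb : 0 < b) :
    1 / Real.sqrt b = 1 / Real.Gamma (1 / 2) * ∫ x in Ioi (0 : ℝ), x ^ (-(1 / 2) : ℝ) * Real.exp (-b * x ^ (1 : ℝ)) := by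
  rw [integral_rpow_mul_exp_neg_mul_rpow one_pos (by norm_num) hb]
  have e1 : (-(-(1 / 2 : ℝ) + 1) / 1) = -(1 / 2) := by norm_num
  have e2 : ((-(1 / 2 : ℝ) + 1) / 1) = 1 / 2 := by norm_num
  rw [e1, e2, Real.rpow_neg hb.le, ← Real.sqrt_eq_rpow]
  have hG : Real.Gamma (1 / 2) ≠ 0 := (Real.Gamma_pos_of_pos (by norm_num)).ne'
  field_simp

/-- **A CAUCHY-TYPE KERNEL IS POSITIVE SEMI-DEFINITE**: for `k_i > 0` and any reals `c_i`, `0 ≤ Σ_{i,j} c_i c_j ∕ √(k_i + k_j)` — with §2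
`inv_sqrt_eq_gamma_integral` the double sum is `Γ(½)⁻¹·∫_0^∞ x^{−1∕2}·(Σ_i c_i e^{−k_i x})² dx`. [folklore] -/
theorem sum_mul_div_sqrt_add_nonneg {ι : Type*} (S : Finset ι) (k c : ι → ℝ) (hk : ∀ i ∈ S, 0 < k i) :
    0 ≤ ∑ i ∈ S, ∑ j ∈ S, c i * c j / Real.sqrt (k i + k j) := by
  have hG : 0 < Real.Gamma (1 / 2) := Real.Gamma_pos_of_pos (by norm_num)
  set F : ι → ι → ℝ → ℝ := fun i j x => (c i * c j) * (x ^ (-(1 / 2) : ℝ) * Real.exp (-(k i + k j) * x ^ (1 : ℝ))) with hF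
  have hint : ∀ i ∈ S, ∀ j ∈ S, Integrable (F i j) (volume.restrict (Ioi 0)) := by
    intro i hi j hj
    exact (integrableOn_rpow_mul_exp_neg_mul_rpow (by norm_num) le_rfl (add_pos (hk i hi) (hk j hj))).const_mul _
  have hterm : ∀ i ∈ S, ∀ j ∈ S, c i * c j / Real.sqrt (k i + k j) = 1 / Real.Gamma (1 / 2) * ∫ x in Ioi (0 : ℝ), F i j x := by
    intro i hi j hj
    rw [div_eq_mul_one_div, inv_sqrt_eq_gamma_integral (add_pos (hk i hi) (hk j hj)), hF]
    simp only
    rw [integral_const_mul]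
    ring
  rw [sum_congr rfl fun i hi => sum_congr rfl fun j hj => hterm i hi j hj]
  simp only [← mul_sum]
  refine mul_nonneg (by positivity) ?_
  rw [sum_congr rfl fun i hi => (integral_finsetSum S fun j hj => hint i hi j hj).symm,
    ← integral_finsetSum S fun i hi => integrable_finsetSum S fun j hj => hint i hi j hj]
  refine setIntegral_nonneg measurableSet_Ioi fun x hx => ?_
  have hsq : ∑ i ∈ S, ∑ j ∈ S, F i j x
      = x ^ (-(1 / 2) : ℝ) * (∑ i ∈ S, c i * Real.exp (-k i * x ^ (1 : ℝ))) ^ 2 := by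
    rw [pow_two, sum_mul_sum, mul_sum]
    refine sum_congr rfl fun i _ => ?_
    rw [mul_sum]
    refine sum_congr rfl fun j _ => ?_
    simp only [hF]
    have : Real.exp (-(k i + k j) * x ^ (1 : ℝ)) = Real.exp (-k i * x ^ (1 : ℝ)) * Real.exp (-k j * x ^ (1 : ℝ)) := by
      rw [← Real.exp_add]; congr 1; ring
    rw [this]; ring
  rw [hsq]
  exact mul_nonneg (Real.rpow_nonneg (le_of_lt hx) _) (sq_nonneg _)

/-- **THE GEOMETRIC AGE KERNEL IS POSITIVE SEMI-DEFINITE**: for ages `k_i > 0` and any reals `g_i`,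
`0 ≤ Σ_{i,j} √(√(k_i∕(k_i+k_j))·√(k_j∕(k_j+k_i)))·g_i·g_j` — the kernel is `(k_ik_j)^{1∕4}∕√(k_i+k_j) = c_ic_j∕√(k_i+k_j)` with `c_i = g_i·k_i^{1∕4}`.
The hypothesis `hpsd` of §1 for the profile kernel `s_jk = √(j∕(j+k))`. [folklore] -/
theorem geomRead_psd {ι : Type*} (S : Finset ι) (k g : ι → ℝ) (hk : ∀ i ∈ S, 0 < k i) :
    0 ≤ ∑ i ∈ S, ∑ j ∈ S, Real.sqrt (Real.sqrt (k i / (k i + k j)) * Real.sqrt (k j / (k j + k i))) * g i * g j := by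
  have key := sum_mul_div_sqrt_add_nonneg S k (fun i => g i * Real.sqrt (Real.sqrt (k i))) hk
  refine le_of_le_of_eq key (sum_congr rfl fun i hi => sum_congr rfl fun j hj => ?_)
  have hi := hk i hi
  have hj := hk j hj
  have hij : 0 < k i + k j := add_pos hi hj
  have e : Real.sqrt (k i / (k i + k j)) * Real.sqrt (k j / (k j + k i)) = Real.sqrt (k i) * Real.sqrt (k j) / (k i + k j) := by
    rw [← Real.sqrt_mul (div_nonneg hi.le hij.le), ← Real.sqrt_mul hi.le]
    have : k i / (k i + k j) * (k j / (k j + k i)) = k i * k j / (k i + k j) ^ 2 := by field_simp; ring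
    rw [this, Real.sqrt_div' _ (by positivity), Real.sqrt_sq hij.le]
  rw [e, Real.sqrt_div' _ hij.le, Real.sqrt_mul (Real.sqrt_nonneg _)]
  field_simp

/-- The geometric age kernel on natural indices (index `0` allowed: its row vanishes, Lean's `0∕0 = 0`) is positive semi-definite. [folklore] -/
theorem geomRead_psd_nat (S : Finset ℕ) (g : ℕ → ℝ) :
    0 ≤ ∑ i ∈ S, ∑ j ∈ S,
      Real.sqrt (Real.sqrt ((i : ℝ) / ((i : ℝ) + j)) * Real.sqrt ((j : ℝ) / ((j : ℝ) + i))) * g i * g j := by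
  set T : ℕ → ℕ → ℝ := fun i j =>
    Real.sqrt (Real.sqrt ((i : ℝ) / ((i : ℝ) + j)) * Real.sqrt ((j : ℝ) / ((j : ℝ) + i))) * g i * g j with hT
  change 0 ≤ ∑ i ∈ S, ∑ j ∈ S, T i j
  have hT0 : ∀ i j, i = 0 ∨ j = 0 → T i j = 0 := by
    rintro i j (rfl | rfl) <;> simp [hT]
  have hrestrict : ∑ i ∈ S, ∑ j ∈ S, T i j = ∑ i ∈ S.filter (· ≠ 0), ∑ j ∈ S.filter (· ≠ 0), T i j := by
    rw [sum_filter]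
    refine sum_congr rfl fun i _ => ?_
    rw [sum_filter]
    split_ifs with hi
    · exact sum_congr rfl fun j _ => by
        split_ifs with hj
        · rfl
        · exact hT0 i j (Or.inr (not_not.mp hj))
    · exact sum_eq_zero fun j _ => hT0 i j (Or.inl (not_not.mp hi))
  rw [hrestrict]
  have key := geomRead_psd (S.filter (· ≠ 0)) (fun i : ℕ => (i : ℝ)) g
    (fun i hi => by exact_mod_cast Nat.pos_of_ne_zero (mem_filter.mp hi).2)
  simpa [hT] using key

/-! ## §3 The conditional sharp window theorem: the CHORD INEQUALITY at the support ⟹ `Σ_j L_j∕P_j ≤ 2∕(ρ + σ(K₀,K₁))`, the two-point value -/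

variable {L : ℕ → ℝ} {K : ℕ}

/-- **THE SHARP WINDOW BOUND, CONDITIONAL ON THE CHORD INEQUALITY.**  `L ≥ 0` with every age `k ≥ 1` of non-zero weight in `[K₀, K₁]` (`1 ≤ K₀ ≤ K₁ < K`;
the number of ages, their sizes and the Markov weight `L_0` ARBITRARY), and at every such age `m` the CHORD INEQUALITY of the geometric read
`σ(i,j) = (ij)^{1∕4}∕√(i+j)`: **`ρ + σ(K₀,K₁) ≤ σ(m,K₀) + σ(m,K₁)`** (`ρ = √(1∕2) = σ(m,m)`; in the coordinate `log k`: `ψ(0) + ψ(ℓ) ≤ ψ(s) + ψ(ℓ − s)`,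
`ψ(u) = (2cosh(u∕2))^{−1∕2}` — numerically true for `ℓ = log(K₁∕K₀)` up to `≈ log 300`).  THEN **`Σ_{j<K} L_j∕P_j ≤ 2∕(ρ + σ(K₀,K₁))`** — the EXACT
supremum over profiles on the window (attained by the two extreme ages with weights `1 : (K₁∕K₀)^{1∕4}`), `≤ 2` iff `ρ + σ(K₀,K₁) ≥ 1` iff
`K₁∕K₀ ≤ 133.87…`.  §1 with the reference vector `ν = ½(δ_{K₀} + δ_{K₁})` (potential `½(σ(i,K₀) + σ(i,K₁)) ≥ c = ½(ρ + σ(K₀,K₁))` by the chord inequality,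
energy `E = ½(ρ + σ(K₀,K₁))`, `2c − E = E`) and §2 (`geomRead_psd_nat`).  What remains for gen 100's WINDOW CONJECTURE (E58b-W) at its sharp constant is
the chord inequality as a statement about `ψ` alone. [folklore] -/
theorem profileSum_le_two_point_of_chord {K₀ K₁ : ℕ} (hL : ∀ k, 0 ≤ L k) (hK₀ : 1 ≤ K₀) (h01 : K₀ ≤ K₁) (hK₁ : K₁ < K)
    (hwin : ∀ k, k ≠ 0 → L k ≠ 0 → K₀ ≤ k ∧ k ≤ K₁)
    (hchord : ∀ m, K₀ ≤ m → m ≤ K₁ → L m ≠ 0 →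
      Real.sqrt (1 / 2) + Real.sqrt (Real.sqrt ((K₀ : ℝ) / ((K₀ : ℝ) + K₁)) * Real.sqrt ((K₁ : ℝ) / ((K₁ : ℝ) + K₀)))
        ≤ Real.sqrt (Real.sqrt ((m : ℝ) / ((m : ℝ) + K₀)) * Real.sqrt ((K₀ : ℝ) / ((K₀ : ℝ) + m)))
          + Real.sqrt (Real.sqrt ((m : ℝ) / ((m : ℝ) + K₁)) * Real.sqrt ((K₁ : ℝ) / ((K₁ : ℝ) + m)))) :
    ∑ j ∈ range K, L j / ∑ k ∈ range K, L k * Real.sqrt ((j : ℝ) / ((j : ℝ) + k))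
      ≤ 2 / (Real.sqrt (1 / 2) + Real.sqrt (Real.sqrt ((K₀ : ℝ) / ((K₀ : ℝ) + K₁)) * Real.sqrt ((K₁ : ℝ) / ((K₁ : ℝ) + K₀)))) := by
  set σ : ℕ → ℕ → ℝ := fun i j => Real.sqrt (Real.sqrt ((i : ℝ) / ((i : ℝ) + j)) * Real.sqrt ((j : ℝ) / ((j : ℝ) + i))) with hσ
  set ρ : ℝ := Real.sqrt (1 / 2) with hρ
  change ∑ j ∈ range K, L j / ∑ k ∈ range K, L k * Real.sqrt ((j : ℝ) / ((j : ℝ) + k)) ≤ 2 / (ρ + σ K₀ K₁)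
  have hρ0 : 0 < ρ := Real.sqrt_pos.2 (by norm_num)
  have hσ0 : ∀ i j, 0 ≤ σ i j := fun i j => Real.sqrt_nonneg _
  have hσsymm : ∀ i j, σ i j = σ j i := fun i j => by simp only [hσ]; rw [mul_comm]
  have hσdiag : ∀ {i : ℕ}, 1 ≤ i → σ i i = ρ := by
    intro i hi
    have hi0 : (0 : ℝ) < i := by exact_mod_cast hi
    have e : (i : ℝ) / ((i : ℝ) + i) = 1 / 2 := by field_simp; ring
    simp only [hσ]
    rw [e, ← pow_two, Real.sqrt_sq (Real.sqrt_nonneg _)]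
  have hK₀K : K₀ ∈ range K := mem_range.2 (lt_of_le_of_lt h01 hK₁)
  have hK₁K : K₁ ∈ range K := mem_range.2 hK₁
  have hK₁1 : 1 ≤ K₁ := le_trans hK₀ h01
  -- the reference vector and its potential
  set ν : ℕ → ℝ := fun j => (if j = K₀ then 1 / 2 else 0) + (if j = K₁ then 1 / 2 else 0) with hν
  have hpotential : ∀ i, ∑ j ∈ range K, σ i j * ν j = σ i K₀ / 2 + σ i K₁ / 2 := by
    intro i
    simp only [hν, mul_add, sum_add_distrib, mul_ite, mul_zero, sum_ite_eq', hK₀K, hK₁K, if_true]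
    ring
  have henergy : ∑ i ∈ range K, ∑ j ∈ range K, σ i j * ν i * ν j = (ρ + σ K₀ K₁) / 2 := by
    have e1 : ∀ i, ∑ j ∈ range K, σ i j * ν i * ν j = ν i * (σ i K₀ / 2 + σ i K₁ / 2) := by
      intro i
      rw [← hpotential i, mul_sum]
      exact sum_congr rfl fun j _ => by ring
    rw [sum_congr rfl fun i _ => e1 i]
    simp only [hν, add_mul, sum_add_distrib, ite_mul, zero_mul, sum_ite_eq', hK₀K, hK₁K, if_true]
    rw [hσdiag hK₀, hσdiag hK₁1, hσsymm K₁ K₀]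
    ring
  have key := sum_div_le_inv_of_psd_potential (S := range K)
    (a := fun i j : ℕ => Real.sqrt ((i : ℝ) / ((i : ℝ) + j))) (L := L)
    (P := fun j => ∑ k ∈ range K, L k * Real.sqrt ((j : ℝ) / ((j : ℝ) + k))) (ν := ν)
    (c := (ρ + σ K₀ K₁) / 2) (fun i j => Real.sqrt_nonneg _) hL (fun i => rfl) (geomRead_psd_nat (range K)) ?_ ?_
  · have e : 2 * ((ρ + σ K₀ K₁) / 2)
        - ∑ i ∈ range K, ∑ j ∈ range K, Real.sqrt (Real.sqrt ((i : ℝ) / ((i : ℝ) + j)) * Real.sqrt ((j : ℝ) / ((j : ℝ) + i))) * ν i * ν j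
        = (ρ + σ K₀ K₁) / 2 := by
      change 2 * ((ρ + σ K₀ K₁) / 2) - ∑ i ∈ range K, ∑ j ∈ range K, σ i j * ν i * ν j = (ρ + σ K₀ K₁) / 2
      rw [henergy]; ring
    rw [e] at key
    refine le_trans key (le_of_eq ?_)
    have : 0 < ρ + σ K₀ K₁ := by have := hσ0 K₀ K₁; linarith
    field_simp
  · -- the potential bound at a supported index: the chord inequality
    intro i _ hf
    have hLi : L i ≠ 0 := by intro h0; rw [h0, zero_div] at hf; exact lt_irrefl _ hf
    have hi0 : i ≠ 0 := by
      rintro rfl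
      have h0 : ∑ k ∈ range K, L k * Real.sqrt (((0 : ℕ) : ℝ) / (((0 : ℕ) : ℝ) + k)) = 0 :=
        sum_eq_zero fun k _ => by simp
      rw [h0, div_zero] at hf
      exact lt_irrefl _ hf
    obtain ⟨h1, h2⟩ := hwin i hi0 hLi
    have hc := hchord i h1 h2 hLi
    change (ρ + σ K₀ K₁) / 2 ≤ ∑ j ∈ range K, σ i j * ν j
    rw [hpotential i]
    change ρ + σ K₀ K₁ ≤ σ i K₀ + σ i K₁ at hc
    linarith
  · change 0 < 2 * ((ρ + σ K₀ K₁) / 2) - ∑ i ∈ range K, ∑ j ∈ range K, σ i j * ν i * ν j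
    rw [henergy]
    have := hσ0 K₀ K₁
    linarith

end Summit.QuantumFields.BalabanUV.Beta.EriceRemainderEnclosureHistoryAutonomyComparisonKernelPSD

end
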